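import Mathlib

/-!
# Wall bubbling for `DoorA26` — LEMMA L: soundness of LEXICOGRAPHIC (two-scale) rows for the (M)-sieve's linking instrument (R3)

LINE / STUBS.  Crux `Theses.LacunarySymmetroid.DoorA26` (stmt-ValiantsHypothesis-19979; OPEN, typed, never asserted), line
`Cruxes/DoorA26/Lines/wall_bubbling.lean` (val-idea-15), obligation (M) `Stmt.stub_mixedWalls`.  Memo rev 9/10 `Lines/wall_bubbling_M-sieve.md` §7 locates the
(M) residual at middle walls («staircases») and the (W-split) gap as ONE two-scale LINKING problem and states LEMMA L (§7.4, «for W1, signature first»): for a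
row polynomial `f = Σ_m c_m X^m` vanishing on the realisable Grams and a sequence `G^ν` with coarse-top monomial class `T`, (ii) if `T = {m₁, m₂}` then
`log|c₁G^{ν,m₁}| − log|c₂G^{ν,m₂}| → 0` with opposite signs eventually (an EXACT linear relation among fine heights), and (iii) in general the fine-top
class `T₁ ⊆ T` has ≥ 2 elements and both signs.  idea-15 g4 (2026-08-28T20:11Z, (3)) / crit-5 (19:48Z): «LEMMA L to W1 signature-first as a kernel row BEFORE
any lex-row kill is reported».  This file is that row, def-free and Mathlib-only, in the sequence currency `Case.decide` consumes: top values
`x_m^ν := c_m G^{ν,m}` (m ∈ T, a finite index type), rest `r^ν := Σ_{m∉T} c_m G^{ν,m}`, row `Σ_{m∈T} x_m^ν + r^ν = 0` (= `f(G^ν) = 0`), DOMINATION `r^ν/‖x^ν‖ → 0`.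

* §0 the coarse scale (how DOMINATION is produced from heights): `log_abs_monomial`, `height_monomial` (heights add on monomials: `log|G^{ν,m}|/w → ⟨h, m⟩`),
  `ratio_tendsto_zero_of_log_sub_atBot`, `ratio_tendsto_zero_of_height_lt` (strictly smaller height ⇒ ratio `→ 0`), `rest_dominated`, `dominated_norm_of_dominated_entry`;
* §1 LEMMA L (ii): `lexRow_two` — two top values and a dominated rest: eventually `x·y < 0` and `|x|/|y| → 1`; `lexRow_two_log` — `log|x| − log|y| → 0`;
* §2 LEMMA L (iii): `lexRow_limit_direction` (every limit direction `t` of the sup-normalised top vector has `Σ t_i = 0`, `‖t‖ = 1`), `lexRow_both_signs`,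
  `exists_limit_direction` (compactness), `eventually_pos/neg_of_direction`, `fineHeight_zero_of_direction` (`t_i ≠ 0` ⇒ fine height of `i` relative to the
  max is `0` at EVERY finer scale `w → ∞`), packaged as `lexRow_general` / `lexRow_topClass` (∃ subsequence and `i ≠ j` in the top class, eventually `x_i > 0`,
  `x_j < 0`, both of relative fine height 0 — the memo's «T₁ has ≥ 2 elements and contains both signs») and `lexRow_card_top` ((i): `|T| ≥ 2`).
  For a PRESCRIBED subsequence (one on which the engine's fine heights exist) apply these to `x ∘ ψ`, `r ∘ ψ`.

One scale down these are the engine's existing rows (W1 #3/#7/#8/#17); a necessary condition only — it licenses lexicographic rows, it kills nothing; nothing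
here bears on (M)/(W)/(R), on `DoorA26`, on `MatrixDescartes` (stmt-ValiantsHypothesis-18050) or on `VP ≠ VNP`; registers unchanged.
Seat val-sym-door-p2 g12 (W1 #20), `--supports stmt-ValiantsHypothesis-19979 --as helper`. [folklore] elementary limits / compactness. [this work] packaging for §7.4.
-/

-- `Summit.ValiantsHypothesis.ValiantsHypothesis.…` repeats a component by the D-0017 layout
-- (single-conjunct summit), which the `dupNamespace` linter flags; the name is mandated.
set_option linter.dupNamespace false

namespace Summit.ValiantsHypothesis.ValiantsHypothesis.Theorems.LacunarySymmetroidMatrixDescartes.WallBubbling.SecondOrder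

open Finset Filter Topology
open scoped BigOperators

/-! ## §0 The coarse scale: heights of monomials and domination -/

/-- `log |∏_a g_a^{m_a}| = Σ_a m_a · log|g_a|` for non-zero factors. [folklore] -/
theorem log_abs_monomial {α : Type*} (s : Finset α) (m : α → ℕ) (g : α → ℝ) (hg : ∀ a ∈ s, g a ≠ 0) :
    Real.log |∏ a ∈ s, g a ^ m a| = ∑ a ∈ s, (m a : ℝ) * Real.log |g a| := by
  have hne : ∀ a ∈ s, |g a ^ m a| ≠ 0 := fun a ha => abs_ne_zero.mpr (pow_ne_zero _ (hg a ha))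
  rw [Finset.abs_prod, Real.log_prod hne]
  exact Finset.sum_congr rfl fun a _ => by rw [abs_pow, Real.log_pow]

/-- **Heights add on monomials**: if every member has a height, `log|G_a^ν|/w^ν → h_a`, then the monomial `∏_a (G_a^ν)^{m_a}` has height `⟨h, m⟩ = Σ_a m_a h_a`.
[folklore] -/
theorem height_monomial {α : Type*} (s : Finset α) (m : α → ℕ) (G : ℕ → α → ℝ) (w : ℕ → ℝ) (h : α → ℝ)
    (hG : ∀ ν, ∀ a ∈ s, G ν a ≠ 0)
    (hh : ∀ a ∈ s, Tendsto (fun ν => Real.log |G ν a| / w ν) atTop (𝓝 (h a))) :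
    Tendsto (fun ν => Real.log |∏ a ∈ s, G ν a ^ m a| / w ν) atTop (𝓝 (∑ a ∈ s, (m a : ℝ) * h a)) := by
  have key : Tendsto (fun ν => ∑ a ∈ s, (m a : ℝ) * (Real.log |G ν a| / w ν)) atTop
      (𝓝 (∑ a ∈ s, (m a : ℝ) * h a)) :=
    tendsto_finsetSum s fun a ha => (hh a ha).const_mul _
  refine key.congr fun ν => ?_
  rw [log_abs_monomial s m (G ν) (hG ν), Finset.sum_div]
  exact Finset.sum_congr rfl fun a _ => by rw [mul_div_assoc]

/-- If `log|a^ν| − log|b^ν| → −∞` then `a^ν/b^ν → 0` (no non-vanishing hypothesis needed: `x/0 = 0`). [folklore] -/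
theorem ratio_tendsto_zero_of_log_sub_atBot (a b : ℕ → ℝ)
    (h : Tendsto (fun ν => Real.log |a ν| - Real.log |b ν|) atTop atBot) :
    Tendsto (fun ν => a ν / b ν) atTop (𝓝 0) := by
  have key : ∀ ν, |a ν / b ν| ≤ Real.exp (Real.log |a ν| - Real.log |b ν|) := by
    intro ν
    by_cases ha : a ν = 0
    · rw [ha, zero_div, abs_zero]; exact (Real.exp_pos _).le
    by_cases hb : b ν = 0
    · rw [hb, div_zero, abs_zero]; exact (Real.exp_pos _).le
    rw [Real.exp_sub, Real.exp_log (abs_pos.mpr ha), Real.exp_log (abs_pos.mpr hb), abs_div]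
  rw [tendsto_zero_iff_norm_tendsto_zero]
  refine squeeze_zero (fun ν => norm_nonneg _) (fun ν => ?_) (Real.tendsto_exp_atBot.comp h)
  rw [Real.norm_eq_abs]
  exact key ν

/-- **Strictly smaller height ⇒ negligible**: heights `log|a|/w → α`, `log|b|/w → β` at a scale `w → ∞` with `α < β` give `a/b → 0`. [folklore] -/
theorem ratio_tendsto_zero_of_height_lt (a b w : ℕ → ℝ) (α β : ℝ) (hw : Tendsto w atTop atTop)
    (ha : Tendsto (fun ν => Real.log |a ν| / w ν) atTop (𝓝 α))
    (hb : Tendsto (fun ν => Real.log |b ν| / w ν) atTop (𝓝 β)) (hlt : α < β) :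
    Tendsto (fun ν => a ν / b ν) atTop (𝓝 0) := by
  apply ratio_tendsto_zero_of_log_sub_atBot
  have hd : Tendsto (fun ν => (Real.log |a ν| - Real.log |b ν|) / w ν) atTop (𝓝 (α - β)) := by
    refine (ha.sub hb).congr fun ν => ?_
    rw [sub_div]
  have hev : ∀ᶠ ν in atTop, Real.log |a ν| - Real.log |b ν| ≤ -((β - α) / 2 * w ν) := by
    filter_upwards [hd.eventually (gt_mem_nhds (by linarith : α - β < (α - β) / 2)),
      hw.eventually_gt_atTop 0] with ν h1 h2
    rw [div_lt_iff₀ h2] at h1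
    linarith
  have hlin : Tendsto (fun ν => -((β - α) / 2 * w ν)) atTop atBot :=
    tendsto_neg_atTop_atBot.comp (hw.const_mul_atTop (by linarith : 0 < (β - α) / 2))
  exact tendsto_atBot_mono' atTop hev hlin

/-- A finite sum of dominated terms is dominated. [folklore] -/
theorem rest_dominated {β : Type*} (s : Finset β) (z : ℕ → β → ℝ) (n : ℕ → ℝ)
    (h : ∀ b ∈ s, Tendsto (fun ν => z ν b / n ν) atTop (𝓝 0)) :
    Tendsto (fun ν => (∑ b ∈ s, z ν b) / n ν) atTop (𝓝 0) := by
  have key := tendsto_finsetSum s h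
  rw [Finset.sum_const_zero] at key
  refine key.congr fun ν => ?_
  rw [Finset.sum_div]

/-- Domination relative to ONE non-vanishing top value implies domination relative to the sup norm of the top vector. [folklore] -/
theorem dominated_norm_of_dominated_entry {ι : Type*} [Fintype ι] (x : ℕ → ι → ℝ) (z : ℕ → ℝ) (i : ι)
    (hx : ∀ ν, x ν i ≠ 0) (h : Tendsto (fun ν => z ν / x ν i) atTop (𝓝 0)) :
    Tendsto (fun ν => z ν / ‖x ν‖) atTop (𝓝 0) := by
  rw [tendsto_zero_iff_norm_tendsto_zero] at h ⊢
  refine squeeze_zero (fun ν => norm_nonneg _) (fun ν => ?_) h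
  have hle : |x ν i| ≤ ‖x ν‖ := by
    have := norm_le_pi_norm (x ν) i
    rwa [Real.norm_eq_abs] at this
  rw [Real.norm_eq_abs, Real.norm_eq_abs, abs_div, abs_div, abs_of_nonneg (norm_nonneg _)]
  exact div_le_div_of_nonneg_left (abs_nonneg _) (abs_pos.mpr (hx ν)) hle

/-! ## §1 LEMMA L (ii): two top monomials -/

/-- **LEMMA L (ii).**  If `x^ν + y^ν + r^ν = 0` with the rest dominated by the top pair, `r^ν / max(|x^ν|,|y^ν|) → 0`, and the top pair not eventually
degenerate (`max > 0` eventually), then eventually the two top values have OPPOSITE signs, and `|x^ν|/|y^ν| → 1`. [folklore] -/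
theorem lexRow_two (x y r : ℕ → ℝ) (hsum : ∀ ν, x ν + y ν + r ν = 0)
    (hpos : ∀ᶠ ν in atTop, 0 < max |x ν| |y ν|)
    (hr : Tendsto (fun ν => r ν / max |x ν| |y ν|) atTop (𝓝 0)) :
    (∀ᶠ ν in atTop, x ν * y ν < 0) ∧ Tendsto (fun ν => |x ν| / |y ν|) atTop (𝓝 1) := by
  have habs : Tendsto (fun ν => |r ν| / max |x ν| |y ν|) atTop (𝓝 0) := by
    have h := hr.abs
    rw [abs_zero] at h
    refine h.congr' ?_
    filter_upwards [hpos] with ν hM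
    rw [abs_div, abs_of_pos hM]
  have hsmall : ∀ᶠ ν in atTop, |r ν| / max |x ν| |y ν| < 1 / 4 :=
    habs.eventually (gt_mem_nhds (by norm_num : (0 : ℝ) < 1 / 4))
  have key : ∀ᶠ ν in atTop,
      x ν * y ν < 0 ∧ |(|x ν| / |y ν|) - 1| ≤ 2 * (|r ν| / max |x ν| |y ν|) := by
    filter_upwards [hsmall, hpos] with ν hν hM
    set M := max |x ν| |y ν| with hMdef
    have hrM : |r ν| < M / 4 := by
      have := (div_lt_iff₀ hM).mp hν
      linarith
    have hxy : x ν + y ν = -r ν := by linarith [hsum ν]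
    have e1 : |x ν| ≤ |y ν| + |r ν| := by
      have e : x ν = -(y ν + r ν) := by linarith [hsum ν]
      rw [e, abs_neg]; exact abs_add_le _ _
    have e2 : |y ν| ≤ |x ν| + |r ν| := by
      have e : y ν = -(x ν + r ν) := by linarith [hsum ν]
      rw [e, abs_neg]; exact abs_add_le _ _
    have hx_lb : 3 * M / 4 ≤ |x ν| := by
      rcases le_total |x ν| |y ν| with h | h
      · have : M = |y ν| := max_eq_right h
        linarith
      · have : M = |x ν| := max_eq_left h
        linarith
    have hy_lb : 3 * M / 4 ≤ |y ν| := by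
      rcases le_total |x ν| |y ν| with h | h
      · have : M = |y ν| := max_eq_right h
        linarith
      · have : M = |x ν| := max_eq_left h
        linarith
    have hx0 : 0 < |x ν| := by linarith
    have hy0 : 0 < |y ν| := by linarith
    have habsum : |x ν + y ν| = |r ν| := by rw [hxy, abs_neg]
    refine ⟨?_, ?_⟩
    · -- opposite signs: equal signs would give `|x + y| = |x| + |y| ≥ 3M/2 > |r|`
      rcases lt_trichotomy (x ν) 0 with hx | hx | hx
      · rcases lt_trichotomy (y ν) 0 with hy | hy | hy
        · exfalso
          have : |x ν + y ν| = |x ν| + |y ν| := by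
            rw [abs_of_neg hx, abs_of_neg hy, abs_of_neg (by linarith)]; ring
          linarith
        · exfalso; rw [hy, abs_zero] at hy0; exact lt_irrefl 0 hy0
        · exact mul_neg_of_neg_of_pos hx hy
      · exfalso; rw [hx, abs_zero] at hx0; exact lt_irrefl 0 hx0
      · rcases lt_trichotomy (y ν) 0 with hy | hy | hy
        · exact mul_neg_of_pos_of_neg hx hy
        · exfalso; rw [hy, abs_zero] at hy0; exact lt_irrefl 0 hy0
        · exfalso
          have : |x ν + y ν| = |x ν| + |y ν| := by
            rw [abs_of_pos hx, abs_of_pos hy, abs_of_pos (by linarith)]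
          linarith
    · -- ratio: `| |x|/|y| − 1 | = | |x| − |y| |/|y| ≤ |r|/|y| ≤ 2|r|/M`
      have hdiff : |(|x ν| - |y ν|)| ≤ |r ν| := by
        rw [abs_le]; constructor <;> linarith
      rw [div_sub_one hy0.ne', abs_div, abs_of_pos hy0, div_le_iff₀ hy0]
      calc |(|x ν| - |y ν|)| ≤ |r ν| := hdiff
        _ = (|r ν| / M) * M := (div_mul_cancel₀ _ hM.ne').symm
        _ ≤ (|r ν| / M) * (2 * |y ν|) :=
            mul_le_mul_of_nonneg_left (by linarith) (div_nonneg (abs_nonneg _) hM.le)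
        _ = 2 * (|r ν| / M) * |y ν| := by ring
  refine ⟨key.mono fun ν h => h.1, ?_⟩
  have hr' : Tendsto (fun ν => 2 * (|r ν| / max |x ν| |y ν|)) atTop (𝓝 0) := by
    simpa using habs.const_mul 2
  rw [tendsto_iff_norm_sub_tendsto_zero]
  refine squeeze_zero_norm' ?_ hr'
  filter_upwards [key] with ν hν
  simp only [Real.norm_eq_abs, abs_abs]
  exact hν.2

/-- **LEMMA L (ii), log form**: under the same hypotheses `log|x^ν| − log|y^ν| → 0` — with `x = c₁G^{ν,m₁}`, `y = c₂G^{ν,m₂}` this is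
`log|G^{ν,m₁}| − log|G^{ν,m₂}| → log|c₂/c₁|`, the exact linear relation among fine heights of memo §7.2 (ℓ2). [folklore] -/
theorem lexRow_two_log (x y r : ℕ → ℝ) (hsum : ∀ ν, x ν + y ν + r ν = 0)
    (hpos : ∀ᶠ ν in atTop, 0 < max |x ν| |y ν|)
    (hr : Tendsto (fun ν => r ν / max |x ν| |y ν|) atTop (𝓝 0)) :
    Tendsto (fun ν => Real.log |x ν| - Real.log |y ν|) atTop (𝓝 0) := by
  obtain ⟨hsign, hratio⟩ := lexRow_two x y r hsum hpos hr
  have hlog : Tendsto (fun ν => Real.log (|x ν| / |y ν|)) atTop (𝓝 (Real.log 1)) :=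
    (Real.continuousAt_log one_ne_zero).tendsto.comp hratio
  rw [Real.log_one] at hlog
  refine hlog.congr' ?_
  filter_upwards [hsign] with ν hν
  have hx : x ν ≠ 0 := fun h => by rw [h, zero_mul] at hν; exact lt_irrefl 0 hν
  have hy : y ν ≠ 0 := fun h => by rw [h, mul_zero] at hν; exact lt_irrefl 0 hν
  rw [Real.log_div (abs_ne_zero.mpr hx) (abs_ne_zero.mpr hy)]

/-! ## §2 LEMMA L (iii): a general top class -/

/-- **Limit directions of the top class sum to zero.**  Top values `x^ν : ι → ℝ` (finite `ι`, `x^ν ≠ 0`), rest `r^ν`, row `Σ_i x_i^ν + r^ν = 0`, domination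
`r^ν/‖x^ν‖ → 0`; along any subsequence on which the sup-normalised top vector converges to `t`: `Σ_i t_i = 0` and `‖t‖ = 1`. [folklore] -/
theorem lexRow_limit_direction {ι : Type*} [Fintype ι] (x : ℕ → ι → ℝ) (r : ℕ → ℝ)
    (hsum : ∀ ν, ∑ i, x ν i + r ν = 0) (hx : ∀ ν, x ν ≠ 0)
    (hr : Tendsto (fun ν => r ν / ‖x ν‖) atTop (𝓝 0))
    (φ : ℕ → ℕ) (hφ : StrictMono φ) (t : ι → ℝ)
    (ht : Tendsto (fun k => ‖x (φ k)‖⁻¹ • x (φ k)) atTop (𝓝 t)) :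
    ∑ i, t i = 0 ∧ ‖t‖ = 1 := by
  have hnorm : ∀ k, ‖‖x (φ k)‖⁻¹ • x (φ k)‖ = 1 := fun k => by
    rw [norm_smul, norm_inv, norm_norm, inv_mul_cancel₀ (norm_ne_zero_iff.mpr (hx _))]
  refine ⟨?_, ?_⟩
  · have h1 : Tendsto (fun k => ∑ i, (‖x (φ k)‖⁻¹ • x (φ k)) i) atTop (𝓝 (∑ i, t i)) :=
      tendsto_finsetSum _ fun i _ => (tendsto_pi_nhds.mp ht) i
    have h2 : Tendsto (fun k => ∑ i, (‖x (φ k)‖⁻¹ • x (φ k)) i) atTop (𝓝 0) := by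
      have h3 : Tendsto (fun k => -(r (φ k) / ‖x (φ k)‖)) atTop (𝓝 (-0)) :=
        (hr.comp hφ.tendsto_atTop).neg
      rw [neg_zero] at h3
      refine h3.congr fun k => ?_
      simp only [Pi.smul_apply, smul_eq_mul, ← Finset.mul_sum]
      have e : ∑ i, x (φ k) i = -r (φ k) := by linarith [hsum (φ k)]
      rw [e, div_eq_mul_inv]
      ring
    exact tendsto_nhds_unique h1 h2
  · have h := ht.norm
    simp only [hnorm] at h
    exact (tendsto_nhds_unique tendsto_const_nhds h).symm

/-- **Both signs in the top class**: a vector with `Σ_i t_i = 0` and `‖t‖ = 1` has a strictly positive and a strictly negative entry. [folklore] -/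
theorem lexRow_both_signs {ι : Type*} [Fintype ι] (t : ι → ℝ) (hsum : ∑ i, t i = 0) (hnorm : ‖t‖ = 1) :
    ∃ i j, 0 < t i ∧ t j < 0 := by
  classical
  have hex : ∃ i, t i ≠ 0 := by
    by_contra h
    push Not at h
    have : t = 0 := funext h
    rw [this, norm_zero] at hnorm
    exact zero_ne_one hnorm
  obtain ⟨i, hi⟩ := hex
  rcases lt_or_gt_of_ne hi with hneg | hposi
  · have hj : ∃ j, 0 < t j := by
      by_contra h
      push Not at h
      have : ∑ j, t j < 0 := by
        calc ∑ j, t j = t i + ∑ j ∈ Finset.univ.erase i, t j :=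
              (Finset.add_sum_erase _ _ (Finset.mem_univ i)).symm
          _ < 0 + 0 := add_lt_add_of_lt_of_le hneg (Finset.sum_nonpos fun j _ => h j)
          _ = 0 := by ring
      linarith
    obtain ⟨j, hj⟩ := hj
    exact ⟨j, i, hj, hneg⟩
  · have hj : ∃ j, t j < 0 := by
      by_contra h
      push Not at h
      have : 0 < ∑ j, t j := by
        calc (0 : ℝ) = 0 + 0 := by ring
          _ < t i + ∑ j ∈ Finset.univ.erase i, t j :=
              add_lt_add_of_lt_of_le hposi (Finset.sum_nonneg fun j _ => h j)
          _ = ∑ j, t j := Finset.add_sum_erase _ _ (Finset.mem_univ i)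
      linarith
    obtain ⟨j, hj⟩ := hj
    exact ⟨i, j, hposi, hj⟩

/-- **Existence of limit directions** (compactness of the unit sphere of `ι → ℝ`). [folklore] -/
theorem exists_limit_direction {ι : Type*} [Fintype ι] (x : ℕ → ι → ℝ) (hx : ∀ ν, x ν ≠ 0) :
    ∃ φ : ℕ → ℕ, StrictMono φ ∧ ∃ t : ι → ℝ, Tendsto (fun k => ‖x (φ k)‖⁻¹ • x (φ k)) atTop (𝓝 t) := by
  have hball : ∀ ν, ‖x ν‖⁻¹ • x ν ∈ Metric.closedBall (0 : ι → ℝ) 1 := fun ν => by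
    rw [Metric.mem_closedBall, dist_zero_right, norm_smul, norm_inv, norm_norm,
      inv_mul_cancel₀ (norm_ne_zero_iff.mpr (hx ν))]
  obtain ⟨t, -, φ, hφ, hlim⟩ := tendsto_subseq_of_bounded Metric.isBounded_closedBall hball
  exact ⟨φ, hφ, t, hlim⟩

/-- A coordinate with positive limit direction is eventually positive along the subsequence. [folklore] -/
theorem eventually_pos_of_direction {ι : Type*} [Fintype ι] (x : ℕ → ι → ℝ) (φ : ℕ → ℕ) (t : ι → ℝ)
    (ht : Tendsto (fun k => ‖x (φ k)‖⁻¹ • x (φ k)) atTop (𝓝 t)) (i : ι) (hi : 0 < t i) :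
    ∀ᶠ k in atTop, 0 < x (φ k) i := by
  have h := (tendsto_pi_nhds.mp ht) i
  filter_upwards [h.eventually (lt_mem_nhds hi)] with k hk
  simp only [Pi.smul_apply, smul_eq_mul] at hk
  by_contra hcon
  push Not at hcon
  have : ‖x (φ k)‖⁻¹ * x (φ k) i ≤ 0 :=
    mul_nonpos_of_nonneg_of_nonpos (inv_nonneg.mpr (norm_nonneg _)) hcon
  linarith

/-- A coordinate with negative limit direction is eventually negative along the subsequence. [folklore] -/
theorem eventually_neg_of_direction {ι : Type*} [Fintype ι] (x : ℕ → ι → ℝ) (φ : ℕ → ℕ) (t : ι → ℝ)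
    (ht : Tendsto (fun k => ‖x (φ k)‖⁻¹ • x (φ k)) atTop (𝓝 t)) (i : ι) (hi : t i < 0) :
    ∀ᶠ k in atTop, x (φ k) i < 0 := by
  have h := (tendsto_pi_nhds.mp ht) i
  filter_upwards [h.eventually (gt_mem_nhds hi)] with k hk
  simp only [Pi.smul_apply, smul_eq_mul] at hk
  by_contra hcon
  push Not at hcon
  have : 0 ≤ ‖x (φ k)‖⁻¹ * x (φ k) i := mul_nonneg (inv_nonneg.mpr (norm_nonneg _)) hcon
  linarith

/-- **Non-zero direction ⇒ fine height zero.**  If the normalised coordinate `x_i/‖x‖` tends to `t_i ≠ 0` along the subsequence, then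
`(log|x_i| − log‖x‖)/w → 0` for EVERY scale `w → ∞`: the fine height of `i` relative to the top maximum vanishes (`i ∈ T₁` in memo §7.4 (iii)). [folklore] -/
theorem fineHeight_zero_of_direction {ι : Type*} [Fintype ι] (x : ℕ → ι → ℝ) (φ : ℕ → ℕ) (t : ι → ℝ)
    (ht : Tendsto (fun k => ‖x (φ k)‖⁻¹ • x (φ k)) atTop (𝓝 t)) (i : ι) (hi : t i ≠ 0)
    (w : ℕ → ℝ) (hw : Tendsto w atTop atTop) :
    Tendsto (fun k => (Real.log |x (φ k) i| - Real.log ‖x (φ k)‖) / w k) atTop (𝓝 0) := by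
  have h := (tendsto_pi_nhds.mp ht) i
  simp only [Pi.smul_apply, smul_eq_mul] at h
  have hlog : Tendsto (fun k => Real.log |‖x (φ k)‖⁻¹ * x (φ k) i|) atTop (𝓝 (Real.log |t i|)) :=
    (Real.continuousAt_log (abs_ne_zero.mpr hi)).tendsto.comp h.abs
  have hne : ∀ᶠ k in atTop, x (φ k) i ≠ 0 := by
    filter_upwards [h.eventually (isOpen_ne.eventually_mem (hi : t i ∈ {y : ℝ | y ≠ 0}))] with k hk
    intro h0
    simp only [h0, mul_zero, ne_eq, not_true_eq_false] at hk
  have hlog' : Tendsto (fun k => Real.log |x (φ k) i| - Real.log ‖x (φ k)‖) atTop (𝓝 (Real.log |t i|)) := by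
    refine hlog.congr' ?_
    filter_upwards [hne] with k hk
    have hn : ‖x (φ k)‖ ≠ 0 := by
      intro h0
      apply hk
      have hle := norm_le_pi_norm (x (φ k)) i
      rw [h0, Real.norm_eq_abs] at hle
      exact abs_eq_zero.mp (le_antisymm hle (abs_nonneg _))
    rw [abs_mul, abs_inv, abs_of_nonneg (norm_nonneg _),
      Real.log_mul (inv_ne_zero hn) (abs_ne_zero.mpr hk), Real.log_inv]
    ring
  exact hlog'.div_atTop hw

/-- **LEMMA L (iii), limit-direction form**: row + domination + non-degenerate top ⇒ along some subsequence the fine direction `t` of the top class exists,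
`Σ_i t_i = 0`, `‖t‖ = 1`, and `t` has entries of both signs. [this work] -/
theorem lexRow_general {ι : Type*} [Fintype ι] (x : ℕ → ι → ℝ) (r : ℕ → ℝ)
    (hsum : ∀ ν, ∑ i, x ν i + r ν = 0) (hx : ∀ ν, x ν ≠ 0)
    (hr : Tendsto (fun ν => r ν / ‖x ν‖) atTop (𝓝 0)) :
    ∃ φ : ℕ → ℕ, StrictMono φ ∧ ∃ t : ι → ℝ,
      Tendsto (fun k => ‖x (φ k)‖⁻¹ • x (φ k)) atTop (𝓝 t) ∧
      ∑ i, t i = 0 ∧ ‖t‖ = 1 ∧ ∃ i j, 0 < t i ∧ t j < 0 := by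
  obtain ⟨φ, hφ, t, ht⟩ := exists_limit_direction x hx
  obtain ⟨h1, h2⟩ := lexRow_limit_direction x r hsum hx hr φ hφ t ht
  exact ⟨φ, hφ, t, ht, h1, h2, lexRow_both_signs t h1 h2⟩

/-- **LEMMA L (iii), memo form («T₁ has ≥ 2 elements and contains both signs»)**: row + domination + non-degenerate top ⇒ along some subsequence there
are two top indices `i ≠ j` with `x_i` eventually positive, `x_j` eventually negative, and both of fine height `0` relative to the top maximum at
every finer scale `w → ∞` (taken along the subsequence). [this work] -/
theorem lexRow_topClass {ι : Type*} [Fintype ι] (x : ℕ → ι → ℝ) (r : ℕ → ℝ)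
    (hsum : ∀ ν, ∑ i, x ν i + r ν = 0) (hx : ∀ ν, x ν ≠ 0)
    (hr : Tendsto (fun ν => r ν / ‖x ν‖) atTop (𝓝 0)) :
    ∃ φ : ℕ → ℕ, StrictMono φ ∧ ∃ i j : ι, i ≠ j ∧
      (∀ᶠ k in atTop, 0 < x (φ k) i) ∧ (∀ᶠ k in atTop, x (φ k) j < 0) ∧
      ∀ w : ℕ → ℝ, Tendsto w atTop atTop →
        Tendsto (fun k => (Real.log |x (φ k) i| - Real.log ‖x (φ k)‖) / w k) atTop (𝓝 0) ∧
        Tendsto (fun k => (Real.log |x (φ k) j| - Real.log ‖x (φ k)‖) / w k) atTop (𝓝 0) := by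
  obtain ⟨φ, hφ, t, ht, -, -, i, j, hi, hj⟩ := lexRow_general x r hsum hx hr
  refine ⟨φ, hφ, i, j, fun h => ?_, eventually_pos_of_direction x φ t ht i hi,
    eventually_neg_of_direction x φ t ht j hj, fun w hw => ⟨?_, ?_⟩⟩
  · rw [h] at hi; exact lt_asymm hi hj
  · exact fineHeight_zero_of_direction x φ t ht i hi.ne' w hw
  · exact fineHeight_zero_of_direction x φ t ht j hj.ne w hw

/-- **LEMMA L (i)**: under the same hypotheses the top class has at least two elements. [folklore] -/
theorem lexRow_card_top {ι : Type*} [Fintype ι] (x : ℕ → ι → ℝ) (r : ℕ → ℝ)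
    (hsum : ∀ ν, ∑ i, x ν i + r ν = 0) (hx : ∀ ν, x ν ≠ 0)
    (hr : Tendsto (fun ν => r ν / ‖x ν‖) atTop (𝓝 0)) : 1 < Fintype.card ι := by
  obtain ⟨-, -, i, j, hij, -⟩ := lexRow_topClass x r hsum hx hr
  exact Fintype.one_lt_card_iff_nontrivial.mpr ⟨⟨i, j, hij⟩⟩

end Summit.ValiantsHypothesis.ValiantsHypothesis.Theorems.LacunarySymmetroidMatrixDescartes.WallBubbling.SecondOrder
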